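import Mathlib
import HarnessLib
import Summits.HubbardSuperconductivity.HubbardSuperconductivity.Theorems.KLProgrammeKLRegimeEnginePairTransferOutClassForwardCrossed

/-!
# Route `KLProgramme` — ENGINE item stmt-HubbardSuperconductivity-20437 `KLRegimeEngineV17F2`, stub (c) value lane, «(c)-OUT»: the forward-window CROSSED member line with a
# QUARTER thermal share (cell gate-hubbard-kl, seat hubbard-kl-k3c2-p2 g18, technique «thermal-bar induction n ≤ nScales β + 1»)

Twin of `…OutClassForwardQuarter` for `forward_member_crossed_row_le_phGain` (…OutClassForwardCrossed): thermal size `TH₀ + 2·TR₀ ≤ 2⁷⁶(Klam U)²` ⇒ `thermalBar/4`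
(`forward_row_arith_shift_quarter`, **`forward_member_crossed_row_le_quarter`**).
Composition/arithmetic over landed rows; nothing about the model's kernels is asserted; nothing asserts (E2″-F), (c), K3 or superconductivity.
-/

noncomputable section

namespace Summit.HubbardSuperconductivity.HubbardSuperconductivity.Theorems.KLRegimeSplit

set_option linter.dupNamespace false -- summit = problem name (single-conjunct summit), D-0017

open Real Set Finset Complex Literature.MathematicalPhysics.QuantumLattice
open Literature.Probability.LatticeModels hiding torusSupNorm
open Literature.MathematicalPhysics.QuantumLattice.BandSectorCounting
open Summit.HubbardSuperconductivity.HubbardSuperconductivity.Theorems.KLProgrammeLegKernels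
open Summit.HubbardSuperconductivity.HubbardSuperconductivity.Theorems.KLRegimeWick
open Summit.HubbardSuperconductivity.HubbardSuperconductivity.Theorems.TwoPointAssembly
open Summit.HubbardSuperconductivity.HubbardSuperconductivity.Theorems.EngineV8
open Summit.HubbardSuperconductivity.HubbardSuperconductivity.Theorems.DispersionFlow
open Summit.HubbardSuperconductivity.HubbardSuperconductivity.Theorems.PerturbedFermiCurve

/-! ## The quarter-share crossed line -/

/-- **Booking arithmetic with a frequency shift, quarter thermal share** (`T + 2R ≤ 2⁷⁶K` ⇒ `CF·K·q/4`). -/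
theorem forward_row_arith_shift_quarter {Z T R Lt LL Λ₁ ρ th q G K CF s : ℝ} {n : ℕ} (hΛ : Λ₁ = klE0 * ((4 : ℝ) ^ (n + 1))⁻¹) (hρ : 0 ≤ ρ) (hK : 0 ≤ K)
    (hZ0 : 0 ≤ Z) (hZ : Z ≤ 2 ^ 52 * K) (hT0 : 0 ≤ T) (hR0 : 0 ≤ R) (hTR : T + 2 * R ≤ 2 ^ 76 * K) (hG : 0 ≤ G) (hRG : R * G ≤ 2 ^ 52 * K)
    (hth0 : 0 ≤ th) (hq0 : 0 ≤ q) (hth : th ≤ 4 * q) (hCF : 2 ^ 80 ≤ CF) (hs : s / Λ₁ = 2 * th) :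
    2 * (3 / (2 * π) * (Z * Λ₁ + T * th + R * ((|(0 : ℝ)| + (s + G * ρ)) / Λ₁)) + Lt / LL) ≤
      K * 2 ^ 28 * (2 ^ 24 * ((4 : ℝ) ^ (n + 1))⁻¹ + 2 ^ 24 * ρ / klE0 * (4 : ℝ) ^ (n + 1)) + CF * K * q / 4 + 2 * (Lt / LL) := by
  have hπ := Real.pi_pos
  have hπ3 : (3 : ℝ) ≤ π := by linarith [Real.pi_gt_three]
  have h3π : 3 / (2 * π) ≤ 1 / 2 := by rw [div_le_div_iff₀ (by positivity) (by norm_num)]; linarith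
  have hE0 : (0 : ℝ) < klE0 := by unfold klE0; norm_num
  have h4 : 0 < (4 : ℝ) ^ (n + 1) := by positivity
  have hΛpos : 0 < Λ₁ := by rw [hΛ]; positivity
  rw [abs_zero, zero_add]
  have hsplit : R * ((s + G * ρ) / Λ₁) = 2 * R * th + R * (G * ρ / Λ₁) := by
    have e : R * (s / Λ₁) = 2 * R * th := by rw [hs]; ring
    rw [add_div, mul_add, e]
  have hZt : Z * Λ₁ ≤ K * 2 ^ 28 * (2 ^ 24 * ((4 : ℝ) ^ (n + 1))⁻¹) := by
    have hZK : Z * klE0 ≤ 2 ^ 52 * K := by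
      have : Z * klE0 ≤ Z * 1 := mul_le_mul_of_nonneg_left (by unfold klE0; norm_num) hZ0
      linarith
    calc Z * Λ₁ = (Z * klE0) * ((4 : ℝ) ^ (n + 1))⁻¹ := by rw [hΛ]; ring
      _ ≤ (2 ^ 52 * K) * ((4 : ℝ) ^ (n + 1))⁻¹ := mul_le_mul_of_nonneg_right hZK (by positivity)
      _ = K * 2 ^ 28 * (2 ^ 24 * ((4 : ℝ) ^ (n + 1))⁻¹) := by ring
  have hRt : R * (G * ρ / Λ₁) ≤ K * 2 ^ 28 * (2 ^ 24 * ρ / klE0 * (4 : ℝ) ^ (n + 1)) := by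
    have e1 : R * (G * ρ / Λ₁) = (R * G) * (ρ / Λ₁) := by ring
    have e2 : K * 2 ^ 28 * (2 ^ 24 * ρ / klE0 * (4 : ℝ) ^ (n + 1)) = (2 ^ 52 * K) * (ρ / Λ₁) := by rw [hΛ]; field_simp
    rw [e1, e2]
    exact mul_le_mul_of_nonneg_right hRG (by positivity)
  have hTt : (T + 2 * R) * th ≤ CF * K * q / 4 := by
    have h1 : (T + 2 * R) * th ≤ (T + 2 * R) * (4 * q) := mul_le_mul_of_nonneg_left hth (by positivity)
    have h2 : (T + 2 * R) * (4 * q) ≤ 2 ^ 76 * K * (4 * q) := mul_le_mul_of_nonneg_right hTR (by positivity)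
    have h3 : 2 ^ 80 * (K * q) ≤ CF * (K * q) := mul_le_mul_of_nonneg_right hCF (mul_nonneg hK hq0)
    linarith
  have hsum0 : 0 ≤ Z * Λ₁ + T * th + (2 * R * th + R * (G * ρ / Λ₁)) := by positivity
  rw [hsplit]
  calc 2 * (3 / (2 * π) * (Z * Λ₁ + T * th + (2 * R * th + R * (G * ρ / Λ₁))) + Lt / LL)
      ≤ 2 * (1 / 2 * (Z * Λ₁ + T * th + (2 * R * th + R * (G * ρ / Λ₁))) + Lt / LL) := by
        have := mul_le_mul_of_nonneg_right h3π hsum0; linarith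
    _ = (Z * Λ₁ + (T + 2 * R) * th + R * (G * ρ / Λ₁)) + 2 * (Lt / LL) := by ring
    _ ≤ _ := by linarith

section Model

variable {L M : ℕ} [NeZero L] [NeZero M] {a' b' : ℝ} (B : BandBounds a' b') {R : RenConsts} {U μ : ℝ} {N : ℕ} {K : TrigPolyC4v} {A : ℝ}

/-- **THE FORWARD-WINDOW CROSSED MEMBER LINE, QUARTER THERMAL SHARE** (`TH₀ + 2TR₀ ≤ 2⁷⁶(Klam U)²` ⇒ `thermalBar/4`). -/
theorem forward_member_crossed_row_le_quarter (hR : ∀ j, 0 ≤ R.Gfr j) (hK : FrameOK R U N μ K)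
    (hAb : ∀ p : Momentum, ∀ j ≤ 2, ‖iteratedFDeriv ℝ j (frameShift K) p‖ ≤ A) (hA : 4 * A < B.Dtmin) (hA20 : 4 * A ≤ 1 / 20) (hμ : μ ≤ -0.15)
    (n : ℕ) {t : ℝ} (ht : t ∈ Icc (0 : ℝ) 1) {β : ℝ} (hβ : klBetaMin ≤ β) (hn : n + 1 ≤ nScales β + 1) (hβn : 16 * π / β ≤ klScale klE0 (n + 1))
    (hM : β * (4 * klScale klE0 (n + 1)) / (2 * Real.pi) + 1 ≤ M)
    (Φ : ℕ → ℝ → FreqMomentum L M → ℝ) (hΦ : Φ = fun j t k => (softSymbolCompl L M β μ K (n + 1) j) k + (hubbardCutoffWeightCT L M β μ K (klScale klE0 (n + 1)) k -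
            hubbardCutoffWeightCT L M β μ K (klScale klE0 n + t * (klScale klE0 (n + 1) - klScale klE0 n)) k))
    (Wd : ℝ → FreqMomentum L M → ℝ) (hWd : Wd = fun t k => deriv (fun Λ' : ℝ => hubbardCutoffWeightCT L M β μ K Λ' k) (klScale klE0 n + t * (klScale klE0 (n + 1) - klScale klE0 n)))
    (V : ℕ → ℝ → (Fin 4 → HubbardFieldIdx L M) → ℂ) {j : ℕ} (hj : n + 1 ≤ j) (Qm x y : TorusSite 2 L)
    (hlo : a' < μ - 4 * klScale klE0 (n + 1) - 4 * A) (hhi : μ + 4 * klScale klE0 (n + 1) + 4 * A < b')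
    (hq : (4 + 8 / 3 * R.Gfr 1 * U ^ 2) * klTorusNorm L (Qm - x - y) ≤ klScale klE0 (n + 1) / 8)
    {A₀ LA ε : ℝ} (hA0 : 0 ≤ A₀) (hLA : 0 ≤ LA) (hε : 0 ≤ ε)
    (hY0B : ∀ k : TorusSite 2 L, ‖V j t ![(((omega0 M, k), 0), 1), ((((omega0 M).rev, k + (Qm - x - y)), 1), 0), (((omega0 M, y), 0), 0), ((((omega0 M).rev, Qm - x), 1), 1)] *
        V j t ![(((omega0 M, k), 0), 0), ((((omega0 M).rev, k + (Qm - x - y)), 1), 1), ((((omega0 M).rev, Qm - y), 1), 0), (((omega0 M, x), 0), 1)]‖ ≤ A₀)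
    (hY1B : ∀ k k' : TorusSite 2 L,
      ‖V j t ![(((omega0 M, k), 0), 1), ((((omega0 M).rev, k + (Qm - x - y)), 1), 0), (((omega0 M, y), 0), 0), ((((omega0 M).rev, Qm - x), 1), 1)] *
            V j t ![(((omega0 M, k), 0), 0), ((((omega0 M).rev, k + (Qm - x - y)), 1), 1), ((((omega0 M).rev, Qm - y), 1), 0), (((omega0 M, x), 0), 1)] -
          V j t ![(((omega0 M, k'), 0), 1), ((((omega0 M).rev, k' + (Qm - x - y)), 1), 0), (((omega0 M, y), 0), 0), ((((omega0 M).rev, Qm - x), 1), 1)] *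
            V j t ![(((omega0 M, k'), 0), 0), ((((omega0 M).rev, k' + (Qm - x - y)), 1), 1), ((((omega0 M).rev, Qm - y), 1), 0), (((omega0 M, x), 0), 1)]‖ ≤
        LA * klTorusNorm L (k - k'))
    (hY0A : ∀ k : TorusSite 2 L, ‖V j t ![(((omega0 M, k + -(Qm - x - y)), 0), 1), ((((omega0 M).rev, k), 1), 0), (((omega0 M, y), 0), 0), ((((omega0 M).rev, Qm - x), 1), 1)] *
        V j t ![(((omega0 M, k + -(Qm - x - y)), 0), 0), ((((omega0 M).rev, k), 1), 1), ((((omega0 M).rev, Qm - y), 1), 0), (((omega0 M, x), 0), 1)]‖ ≤ A₀)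
    (hY1A : ∀ k k' : TorusSite 2 L,
      ‖V j t ![(((omega0 M, k + -(Qm - x - y)), 0), 1), ((((omega0 M).rev, k), 1), 0), (((omega0 M, y), 0), 0), ((((omega0 M).rev, Qm - x), 1), 1)] *
            V j t ![(((omega0 M, k + -(Qm - x - y)), 0), 0), ((((omega0 M).rev, k), 1), 1), ((((omega0 M).rev, Qm - y), 1), 0), (((omega0 M, x), 0), 1)] -
          V j t ![(((omega0 M, k' + -(Qm - x - y)), 0), 1), ((((omega0 M).rev, k'), 1), 0), (((omega0 M, y), 0), 0), ((((omega0 M).rev, Qm - x), 1), 1)] *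
            V j t ![(((omega0 M, k' + -(Qm - x - y)), 0), 0), ((((omega0 M).rev, k'), 1), 1), ((((omega0 M).rev, Qm - y), 1), 0), (((omega0 M, x), 0), 1)]‖ ≤
        LA * klTorusNorm L (k - k'))
    (hflat : ∀ (i i' : MatsubaraIdx M) (k k' : TorusSite 2 L), matsubaraInt M i' + 1 = matsubaraInt M i →
      matsubaraFreq β M i ^ 2 ≤ (5 * klScale klE0 (n + 1)) ^ 2 →
      ‖V j t ![(((i, k), 0), 1), (((i', k'), 1), 0), (((omega0 M, y), 0), 0), ((((omega0 M).rev, Qm - x), 1), 1)] *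
            V j t ![(((i, k), 0), 0), (((i', k'), 1), 1), ((((omega0 M).rev, Qm - y), 1), 0), (((omega0 M, x), 0), 1)] -
          V j t ![(((omega0 M, k), 0), 1), ((((omega0 M).rev, k'), 1), 0), (((omega0 M, y), 0), 0), ((((omega0 M).rev, Qm - x), 1), 1)] *
            V j t ![(((omega0 M, k), 0), 0), ((((omega0 M).rev, k'), 1), 1), ((((omega0 M).rev, Qm - y), 1), 0), (((omega0 M, x), 0), 1)]‖ ≤ ε)
    (hβL : β ≤ L) {P : SplitConsts} {M4 : ℝ} (hM40 : 0 ≤ M4)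
    (hM4 : ∀ X, ‖V j t X‖ ≤ M4) (hM4K : M4 * M4 ≤ 2 ^ 3 * (P.Klam * U) ^ 2)
    (hZS : (524288 / Real.pi * (64 * (klScale klE0 (n + 1) / klScale klE0 j) ^ 2 + (2 * (448 / 3 * Real.exp 2) + 8) + 64) * (Real.pi * Real.sqrt 2 / (B.Dtmin - 4 * A) * (2 * LA + 2 * A₀ * (2 / (1 / 10))) / (B.Dtmin - 4 * A) + 2 * A₀ * (1 / (B.Dtmin - 4 * A) ^ 2 + Real.pi * Real.sqrt 2 * (2 + 4 * A) / (B.Dtmin - 4 * A) ^ 3))) ≤ 2 ^ 52 * (P.Klam * U) ^ 2)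
    (hTHR : (393216 / Real.pi * (64 * (klScale klE0 (n + 1) / klScale klE0 j) ^ 2 + (2 * (448 / 3 * Real.exp 2) + 8) + 64) * (2 * A₀ * (Real.pi * Real.sqrt 2 / (B.Dtmin - 4 * A)))) + 2 * (256 / Real.pi * 8 * (2 * A₀ * (Real.pi * Real.sqrt 2 / (B.Dtmin - 4 * A))) * (65 * (8 * (16 : ℝ) ^ (j - (n + 1))) + 17408 / 3 * 1)) ≤ 2 ^ 76 * (P.Klam * U) ^ 2)
    (hTR : (256 / Real.pi * 8 * (2 * A₀ * (Real.pi * Real.sqrt 2 / (B.Dtmin - 4 * A))) * (65 * (8 * (16 : ℝ) ^ (j - (n + 1))) + 17408 / 3 * 1)) * (4 + 8 / 3 * R.Gfr 1 * U ^ 2) ≤ 2 ^ 52 * (P.Klam * U) ^ 2) :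
    (klScale klE0 n - klScale klE0 (n + 1)) * ((β * (L : ℝ) ^ 2) ^ 3)⁻¹ *
      ‖∑ p : FreqMomentum L M, ∑ p' : FreqMomentum L M,
        if matsubaraInt M p'.1 + matsubaraInt M (omega0 M) + matsubaraInt M (omega0 M) + 1 = matsubaraInt M p.1 ∧ p'.2 = p.2 + Qm - x - y then
          ((((((Φ j t p) : ℝ) : ℂ) * (((β * (L : ℝ) ^ 2 : ℝ) : ℂ) * propCT L M β μ K p)) * ((((Wd t p') : ℝ) : ℂ) * (((β * (L : ℝ) ^ 2 : ℝ) : ℂ) * propCT L M β μ K p'))) +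
              (((((Wd t p) : ℝ) : ℂ) * (((β * (L : ℝ) ^ 2 : ℝ) : ℂ) * propCT L M β μ K p)) * ((((Φ j t p') : ℝ) : ℂ) * (((β * (L : ℝ) ^ 2 : ℝ) : ℂ) * propCT L M β μ K p')))) *
            (V j t ![((p, 0), 1), ((p', 1), 0), (((omega0 M, y), 0), 0), ((((omega0 M).rev, Qm - x), 1), 1)] *
              V j t ![((p, 0), 0), ((p', 1), 1), ((((omega0 M).rev, Qm - y), 1), 0), (((omega0 M, x), 0), 1)])
        else 0‖ ≤
      (P.Klam * U) ^ 2 * klEngGeo11.phGain (n + 1) (klTorusNorm L (x + y - Qm)) + thermalBar klEngGeo11 P U β (n + 1) / 4 +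
        2 * ((96 * (512 * LA / klScale klE0 (n + 1) + 32 * A₀ * (4 + 8 / 3 * R.Gfr 1 * U ^ 2) * ((9 * (2 * (448 / 3 * Real.exp 2) + 8) + 4 * 8) + (65 * (8 * (16 : ℝ) ^ (j - (n + 1))) + 17408 / 3 * 1)) / klScale klE0 (n + 1) ^ 2)) / L) + ε * (2048 * 15367) := by
  have hβ0 : 0 < β := lt_of_lt_of_le (by norm_num [klBetaMin]) hβ
  have hL : (0 : ℝ) < L := by exact_mod_cast Nat.pos_of_ne_zero (NeZero.ne L)
  have hβL2 : 0 < β * (L : ℝ) ^ 2 := by positivity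
  have hΛ1 : 0 < klScale klE0 (n + 1) := klth_klScale_pos (n + 1)
  have hΛj : 0 < klScale klE0 j := klth_klScale_pos j
  have hGfr : 0 ≤ R.Gfr 1 := hR 1
  have h83 : 0 ≤ 8 / 3 * R.Gfr 1 * U ^ 2 := by positivity
  have hG4 : 4 ≤ (4 + 8 / 3 * R.Gfr 1 * U ^ 2) := by linarith only [h83]
  have hG0 : 0 ≤ (4 + 8 / 3 * R.Gfr 1 * U ^ 2) := by linarith only [h83]
  have hA0' : 0 ≤ A := (norm_nonneg _).trans (hAb 0 0 (by norm_num))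
  have hdA : 0 < B.Dtmin - 4 * A := by linarith only [hA]
  set dA : ℝ := B.Dtmin - 4 * A with hdAdef
  have hρeq : klTorusNorm L (x + y - Qm) = klTorusNorm L (Qm - x - y) := by
    rw [show x + y - Qm = -(Qm - x - y) by abel, klTorusNorm_neg]
  have hρ0 : 0 ≤ klTorusNorm L (Qm - x - y) := torusSupNorm_nonneg _
  have hρsmall : klTorusNorm L (Qm - x - y) ≤ klScale klE0 (n + 1) / 32 := by
    have h4ρ : 4 * klTorusNorm L (Qm - x - y) ≤ (4 + 8 / 3 * R.Gfr 1 * U ^ 2) * klTorusNorm L (Qm - x - y) := mul_le_mul_of_nonneg_right hG4 hρ0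
    linarith only [h4ρ, hq]
  have hKl : 0 ≤ (P.Klam * U) ^ 2 := sq_nonneg _
  have ha0 : 0 ≤ klScale klE0 n - klScale klE0 (n + 1) := by linarith only [(klmf_klScale_succ_pos_le n).2]
  have hc0 : 0 ≤ ((β * (L : ℝ) ^ 2) ^ 3)⁻¹ := by positivity
  have hMM : 0 ≤ M4 * M4 := mul_nonneg hM40 hM40
  -- (1) the signed crossed row (both rows read at the same positive shift)
  have hsig0 := klms_memberPH_crossed_signed_le β μ K B hR hK hAb hA hA20 hμ n ht hβ hn hβn hM Φ hΦ Wd hWd V hj Qm x y hlo hhi hq hA0 hLA hε hY0B hY1B hY0A hY1A hflat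
  have habs : |-(2 * π / β)| = |2 * π / β| := abs_neg _
  rw [habs] at hsig0
  -- (2) flat remainder and the running member's soft mass
  have hfl := klmsRoom_flat_le (L := L) (M := M) hβ0 μ K n ht (Φ j t) (C := 256 / 3) hε (by norm_num) (by norm_num)
  have hsm : klSoftMass L M β μ K n (Φ j t) ≤ 15367 := by
    subst hΦ; exact klSoftMass_runningMember_le β μ K hK hβ hβL n hj ht
  -- (3) the exact reading (shift `s = |2π/β|`) and the thermal dictionary
  have hread := klmsRowBound_reading B.Dtmin A (4 + 8 / 3 * R.Gfr 1 * U ^ 2) A₀ LA β n j (|2 * π / β| + (4 + 8 / 3 * R.Gfr 1 * U ^ 2) * klTorusNorm L (Qm - x - y)) L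
  have hnβ : n ≤ nScales β := by omega
  have hth := klmsRoom_thermal_le hβ hnβ
  have hq4 : ((4 : ℝ) ^ (nScales β - n))⁻¹ ≤ ((4 : ℝ) ^ (nScales β - (n + 1)))⁻¹ :=
    inv_anti₀ (by positivity) (pow_le_pow_right₀ (by norm_num) (by omega))
  have hth' : Real.pi / β / klScale klE0 (n + 1) ≤ 4 * ((4 : ℝ) ^ (nScales β - (n + 1)))⁻¹ := hth.trans (by linarith only [hq4])
  have hth0 : 0 ≤ Real.pi / β / klScale klE0 (n + 1) := by positivity
  have hs : |2 * π / β| / klScale klE0 (n + 1) = 2 * (Real.pi / β / klScale klE0 (n + 1)) := by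
    rw [abs_of_pos (by positivity)]; ring
  have harith := forward_row_arith_shift_quarter (LL := (L : ℝ)) (Lt := (96 * (512 * LA / klScale klE0 (n + 1) + 32 * A₀ * (4 + 8 / 3 * R.Gfr 1 * U ^ 2) * ((9 * (2 * (448 / 3 * Real.exp 2) + 8) + 4 * 8) + (65 * (8 * (16 : ℝ) ^ (j - (n + 1))) + 17408 / 3 * 1)) / klScale klE0 (n + 1) ^ 2))) (rfl : klScale klE0 (n + 1) = klE0 * ((4 : ℝ) ^ (n + 1))⁻¹) hρ0 hKl
    (by positivity) hZS (by positivity) (by positivity) hTHR hG0 hTR hth0 (by positivity) hth' two_pow_eighty_le_klEngGeo11_CF hs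
  have hTB : klEngGeo11.CF * (P.Klam * U) ^ 2 * ((4 : ℝ) ^ (nScales β - (n + 1)))⁻¹ = thermalBar klEngGeo11 P U β (n + 1) := rfl
  have hTB0 : 0 ≤ thermalBar klEngGeo11 P U β (n + 1) := by
    rw [← hTB]; exact mul_nonneg (mul_nonneg klEngGeo11_CF_nonneg hKl) (by positivity)
  -- (4) the sign-blind factorisation
  have hK4 : ∀ X X', ‖V j t X * V j t X'‖ ≤ M4 * M4 := fun X X' => by
    rw [norm_mul]; exact mul_le_mul (hM4 X) (hM4 X') (norm_nonneg _) hM40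
  have hfac := klmd_sum2_ite_mul_le
    (fun (p : FreqMomentum L M) (p' : FreqMomentum L M) =>
      matsubaraInt M p'.1 + matsubaraInt M (omega0 M) + matsubaraInt M (omega0 M) + 1 = matsubaraInt M p.1 ∧ p'.2 = p.2 + Qm - x - y)
    (fun (p : FreqMomentum L M) (p' : FreqMomentum L M) =>
      ((((((Φ j t p) : ℝ) : ℂ) * (((β * (L : ℝ) ^ 2 : ℝ) : ℂ) * propCT L M β μ K p)) * ((((Wd t p') : ℝ) : ℂ) * (((β * (L : ℝ) ^ 2 : ℝ) : ℂ) * propCT L M β μ K p'))) +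
        (((((Wd t p) : ℝ) : ℂ) * (((β * (L : ℝ) ^ 2 : ℝ) : ℂ) * propCT L M β μ K p)) * ((((Φ j t p') : ℝ) : ℂ) * (((β * (L : ℝ) ^ 2 : ℝ) : ℂ) * propCT L M β μ K p')))))
    (fun (p : FreqMomentum L M) (p' : FreqMomentum L M) =>
      V j t ![((p, 0), 1), ((p', 1), 0), (((omega0 M, y), 0), 0), ((((omega0 M).rev, Qm - x), 1), 1)] *
        V j t ![((p, 0), 0), ((p', 1), 1), ((((omega0 M).rev, Qm - y), 1), 0), (((omega0 M, x), 0), 1)])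
    (fun _ _ _ => hK4 _ _)
  beta_reduce at hfac
  have hmass : (klScale klE0 n - klScale klE0 (n + 1)) * ((β * (L : ℝ) ^ 2) ^ 3)⁻¹ *
      (∑ p : FreqMomentum L M, ∑ p' : FreqMomentum L M,
          (if matsubaraInt M p'.1 + matsubaraInt M (omega0 M) + matsubaraInt M (omega0 M) + 1 = matsubaraInt M p.1 ∧ p'.2 = p.2 + Qm - x - y then
            ‖(((((Φ j t p) : ℝ) : ℂ) * (((β * (L : ℝ) ^ 2 : ℝ) : ℂ) * propCT L M β μ K p)) * ((((Wd t p') : ℝ) : ℂ) * (((β * (L : ℝ) ^ 2 : ℝ) : ℂ) * propCT L M β μ K p'))) +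
              (((((Wd t p) : ℝ) : ℂ) * (((β * (L : ℝ) ^ 2 : ℝ) : ℂ) * propCT L M β μ K p)) * ((((Φ j t p') : ℝ) : ℂ) * (((β * (L : ℝ) ^ 2 : ℝ) : ℂ) * propCT L M β μ K p')))‖
          else 0)) ≤ 2048 * 15367 := by
    have h := (Wx_member_row_flat_le (M := M) β μ K hK hβ hβL n hj ht Qm x y).trans (show (1024 : ℝ) * 15367 ≤ 2048 * 15367 by norm_num)
    simp only [hΦ, hWd]
    exact h
  -- (5) abbreviate and assemble
  set a : ℝ := klScale klE0 n - klScale klE0 (n + 1) with ha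
  set c : ℝ := ((β * (L : ℝ) ^ 2) ^ 3)⁻¹ with hc
  set nS : ℝ := ‖∑ p : FreqMomentum L M, ∑ p' : FreqMomentum L M,
        if matsubaraInt M p'.1 + matsubaraInt M (omega0 M) + matsubaraInt M (omega0 M) + 1 = matsubaraInt M p.1 ∧ p'.2 = p.2 + Qm - x - y then
          ((((((Φ j t p) : ℝ) : ℂ) * (((β * (L : ℝ) ^ 2 : ℝ) : ℂ) * propCT L M β μ K p)) * ((((Wd t p') : ℝ) : ℂ) * (((β * (L : ℝ) ^ 2 : ℝ) : ℂ) * propCT L M β μ K p'))) +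
              (((((Wd t p) : ℝ) : ℂ) * (((β * (L : ℝ) ^ 2 : ℝ) : ℂ) * propCT L M β μ K p)) * ((((Φ j t p') : ℝ) : ℂ) * (((β * (L : ℝ) ^ 2 : ℝ) : ℂ) * propCT L M β μ K p')))) *
            (V j t ![((p, 0), 1), ((p', 1), 0), (((omega0 M, y), 0), 0), ((((omega0 M).rev, Qm - x), 1), 1)] *
              V j t ![((p, 0), 0), ((p', 1), 1), ((((omega0 M).rev, Qm - y), 1), 0), (((omega0 M, x), 0), 1)])
        else 0‖ with hnS
  set Sx : ℝ := ∑ p : FreqMomentum L M, ∑ p' : FreqMomentum L M,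
          (if matsubaraInt M p'.1 + matsubaraInt M (omega0 M) + matsubaraInt M (omega0 M) + 1 = matsubaraInt M p.1 ∧ p'.2 = p.2 + Qm - x - y then
            ‖(((((Φ j t p) : ℝ) : ℂ) * (((β * (L : ℝ) ^ 2 : ℝ) : ℂ) * propCT L M β μ K p)) * ((((Wd t p') : ℝ) : ℂ) * (((β * (L : ℝ) ^ 2 : ℝ) : ℂ) * propCT L M β μ K p'))) +
              (((((Wd t p) : ℝ) : ℂ) * (((β * (L : ℝ) ^ 2 : ℝ) : ℂ) * propCT L M β μ K p)) * ((((Φ j t p') : ℝ) : ℂ) * (((β * (L : ℝ) ^ 2 : ℝ) : ℂ) * propCT L M β μ K p')))‖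
          else 0) with hSx
  set T' : ℝ := thermalBar klEngGeo11 P U β (n + 1) / 4 + 2 * ((96 * (512 * LA / klScale klE0 (n + 1) + 32 * A₀ * (4 + 8 / 3 * R.Gfr 1 * U ^ 2) * ((9 * (2 * (448 / 3 * Real.exp 2) + 8) + 4 * 8) + (65 * (8 * (16 : ℝ) ^ (j - (n + 1))) + 17408 / 3 * 1)) / klScale klE0 (n + 1) ^ 2)) / L) + ε * (2048 * 15367) with hT'
  have hT'0 : 0 ≤ T' := by rw [hT']; exact add_nonneg (add_nonneg (by linarith only [hTB0]) (by positivity)) (by positivity)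
  have hac : 0 ≤ a * c := mul_nonneg ha0 hc0
  have hb_le : a * c * nS ≤ 2 * (a * klmsRowBound B.Dtmin A (4 + 8 / 3 * R.Gfr 1 * U ^ 2) A₀ LA β n j (|2 * π / β| + (4 + 8 / 3 * R.Gfr 1 * U ^ 2) * klTorusNorm L (Qm - x - y)) L) + ε * (2048 * 15367) := by
    have e : a * c * ((β * (L : ℝ) ^ 2) ^ 2 * (β * (L : ℝ) ^ 2 * klmsRowBound B.Dtmin A (4 + 8 / 3 * R.Gfr 1 * U ^ 2) A₀ LA β n j (|2 * π / β| + (4 + 8 / 3 * R.Gfr 1 * U ^ 2) * klTorusNorm L (Qm - x - y)) L + β * (L : ℝ) ^ 2 * klmsRowBound B.Dtmin A (4 + 8 / 3 * R.Gfr 1 * U ^ 2) A₀ LA β n j (|2 * π / β| + (4 + 8 / 3 * R.Gfr 1 * U ^ 2) * klTorusNorm L (Qm - x - y)) L)) = 2 * (a * klmsRowBound B.Dtmin A (4 + 8 / 3 * R.Gfr 1 * U ^ 2) A₀ LA β n j (|2 * π / β| + (4 + 8 / 3 * R.Gfr 1 * U ^ 2) * klTorusNorm L (Qm - x - y)) L)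 := by
      rw [hc]; field_simp; ring
    have h1 := mul_le_mul_of_nonneg_left hsig0 hac
    rw [mul_add, e] at h1
    have h2 : ε * (2048 * klSoftMass L M β μ K n (Φ j t)) ≤ ε * (2048 * 15367) := mul_le_mul_of_nonneg_left (by linarith only [hsm]) hε
    linarith only [h1, hfl, h2]
  have h2 : a * c * nS ≤ (P.Klam * U) ^ 2 * 2 ^ 28 * (2 ^ 24 * ((4 : ℝ) ^ (n + 1))⁻¹ + 2 ^ 24 * klTorusNorm L (Qm - x - y) / klE0 * (4 : ℝ) ^ (n + 1)) + T' := by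
    rw [hread] at hb_le
    rw [hT', ← hTB]
    linarith only [hb_le, harith]
  have h1 : a * c * nS ≤ (P.Klam * U) ^ 2 * 2 ^ 28 + T' := by
    have hmS : a * c * nS ≤ M4 * M4 * (a * c * Sx) := by
      calc a * c * nS ≤ a * c * (M4 * M4 * Sx) := mul_le_mul_of_nonneg_left hfac hac
        _ = M4 * M4 * (a * c * Sx) := by ring
    have h3 : M4 * M4 * (a * c * Sx) ≤ M4 * M4 * (2048 * 15367) := mul_le_mul_of_nonneg_left hmass hMM
    have h4 : M4 * M4 * (2048 * 15367) ≤ 2 ^ 3 * (P.Klam * U) ^ 2 * (2048 * 15367) := mul_le_mul_of_nonneg_right hM4K (by norm_num)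
    have h5 : 2 ^ 3 * (P.Klam * U) ^ 2 * (2048 * 15367) ≤ (P.Klam * U) ^ 2 * 2 ^ 28 := by
      have : (2 : ℝ) ^ 3 * (2048 * 15367) ≤ 2 ^ 28 := by norm_num
      nlinarith only [this, hKl]
    linarith only [hmS, h3, h4, h5, hT'0]
  have h3 : 0 < klTorusNorm L (Qm - x - y) →
      a * c * nS ≤ (P.Klam * U) ^ 2 * 2 ^ 28 * (2 ^ 24 * (klE0 * ((4 : ℝ) ^ (n + 1))⁻¹) / klTorusNorm L (Qm - x - y) +
        2 ^ 24 * Real.sqrt klE0 * ((2 : ℝ) ^ (n + 1))⁻¹) + T' := fun hρ => by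
    have hsc : klE0 * ((4 : ℝ) ^ (n + 1))⁻¹ = klScale klE0 (n + 1) := rfl
    have hA1 : 1 ≤ 2 ^ 24 * (klE0 * ((4 : ℝ) ^ (n + 1))⁻¹) / klTorusNorm L (Qm - x - y) := by
      rw [hsc, one_le_div hρ]; linarith only [hρsmall, hΛ1]
    have hX : (P.Klam * U) ^ 2 * 2 ^ 28 ≤ (P.Klam * U) ^ 2 * 2 ^ 28 *
        (2 ^ 24 * (klE0 * ((4 : ℝ) ^ (n + 1))⁻¹) / klTorusNorm L (Qm - x - y) + 2 ^ 24 * Real.sqrt klE0 * ((2 : ℝ) ^ (n + 1))⁻¹) := by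
      have hA2 : 0 ≤ 2 ^ 24 * Real.sqrt klE0 * ((2 : ℝ) ^ (n + 1))⁻¹ := by positivity
      have h := mul_le_mul_of_nonneg_left (show (1 : ℝ) ≤ 2 ^ 24 * (klE0 * ((4 : ℝ) ^ (n + 1))⁻¹) / klTorusNorm L (Qm - x - y) +
        2 ^ 24 * Real.sqrt klE0 * ((2 : ℝ) ^ (n + 1))⁻¹ by linarith) (by positivity : (0 : ℝ) ≤ (P.Klam * U) ^ 2 * 2 ^ 28)
      rwa [mul_one] at h
    linarith only [h1, hX]
  have hG5 := klg5_phGain_reading (n := n + 1) hρ0 h1 h2 h3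
  have hlift := mul_le_mul_of_nonneg_left (klEngGeo5_phGain_le_klEngGeo11 (n + 1) (klTorusNorm L (Qm - x - y))) hKl
  rw [hT'] at hG5
  rw [hρeq]
  linarith only [hG5, hlift]

end Model

end Summit.HubbardSuperconductivity.HubbardSuperconductivity.Theorems.KLRegimeSplit

end
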